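import Literature.Barriers.Parity.SiegelZeroPrimePairsCnHalf
import Literature.Barriers.Parity.SiegelZeroPrimePairsRoughSums
import Literature.NumberTheory.Sieve.ShiuTheoremProofs
import HarnessLib

/-!
# Matomäki–Merikoski, Lemma 2.1: the `τ(n) c_{n+h}`-part of the error of (2.6), by structure and the pair sieve

Sibling of `SiegelZeroPrimePairsCnSum.lean` / `SiegelZeroPrimePairsCnHalf.lean`, which bound the `τ`-free term
`∑_{adm} c_n` of the error in (2.6) of Matomäki–Merikoski (*Siegel zeros, twin primes …*, IMRN 2023,
arXiv:2112.11412; tree: `MatomakiMerikoski2023_eq26`).  This file PROVES a bound for the companion term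
`∑_{adm n ≤ N} τ(n) c_{n+h}` (`c = λ' − Λ`, `λ' = χ ∗ log`, "adm": every prime factor of `n` and of `n + h` is
`≥ z` and does not divide `q`) in the presence of the exceptional zero, WITHOUT Henriot's Nair–Tenenbaum bound
(the source's Lemma 3.1 (ii), which its proof of Lemma 2.1 applies also to moduli `m` as large as `4X/z`,
outside the uniformity range of that bound):

* structure (`charLog_sub_vonMangoldt_le_of_squarefree`): on a square-free admissible `m`,
  `c_m = ∑_{p ∣ m, p ≠ m} λ(m/p) log p` and `λ(e) = ∏_{p ∣ e} (1 + χ(p))` vanishes unless every prime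
  factor of `e` is exceptional (`χ(p) ≠ −1`), in which case `λ(e) = 2^{ω(e)}`; so `c_{n+h} ≠ 0` forces
  `n + h = p · e` with `e > 1` composed of exceptional primes;
* the count of such `n` for a given `e` is a two-dimensional sieve problem for the pair of linear forms
  `(k + (m₀ + 1), ek + (e − r))` (`h = e m₀ + r`, `0 ≤ r < e`, `p = k + m₀ + 1`, `n = pe − h`), of
  determinant `h`, uniform in `e` AND in `h` (no hypothesis `h < z`): the tree's
  `PairLinearSieve.card_sifted_le` gives `≪ (eh/φ(eh)) ((N+h)/e)/log² z`;
* the exceptional primes are sparse at a Siegel zero: `∑_{e} 2^{ω(e)}/e ≤ exp(2 ∑_{z ≤ p ≤ N+h, exc} 1/p) − 1`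
  and `∑_{exc} 1/p ≪ 1/(v²η^{v/2}) + (v/η) log(N+h)/log z` (`z = q^v`; tree: `exists_sum_excPrimes_window_le`,
  Matomäki–Merikoski Lemma 4.1 / Tao–Teräväinen Prop. 3.5);
* `τ(n) ≤ 2^{Ω(n)} ≤ 2^{log N/log z}` on rough `n`, and the non-square-free `n + h` are `≪ N/z + √N` in number.

The price for avoiding Henriot's bound is the factor `2^{log N/log z}` (`= 2^u` for `z = N^{1/u}`) in place of
the source's `u⁴`; this is harmless for `u ≍ √(log η)` (Corollary 1.1 (i) of the source) but not for the
choice `u ≍ log η` behind the third error term of its Theorem 1.3.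

## References

* K. Matomäki, J. Merikoski, IMRN 2023 (arXiv:2112.11412), Lemma 2.1 and its proof (p. 9–10), Lemma 4.1.
  [cite: MatomakiMerikoski2023, Lemma 2.1]
* T. Tao, J. Teräväinen, J. London Math. Soc. (2) 106 (2022), Proposition 3.5. [cite: TaoTeravainen2021, Proposition 3.5]
-/

noncomputable section

open Finset Real
open scoped ArithmeticFunction.vonMangoldt

namespace Literature.Barriers.Parity.MatomakiMerikoski

open Literature.Barriers.Parity.TaoTeravainen
open Literature.NumberTheory.LFunctions
open Literature.NumberTheory.Sieve (PairLinearSieve.card_sifted_le PairLinearSieve.det)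

/-! ### `τ ≤ 2^Ω ≤ 2^{log N/log z}` on rough numbers -/

/-- `τ(n) ≤ 2^{log Y/log z}` for a `z`-rough `n ≤ Y` (`z > 1`). [folklore] -/
theorem card_divisors_le_two_rpow_of_rough {n : ℕ} (hn : n ≠ 0) {z Y : ℝ} (hz : 1 < z)
    (hr : ∀ p ∈ n.primeFactors, z ≤ (p : ℝ)) (hnY : (n : ℝ) ≤ Y) :
    (n.divisors.card : ℝ) ≤ (2 : ℝ) ^ (Real.log Y / Real.log z) := by
  have h1 : (n.divisors.card : ℝ) ≤ (2 : ℝ) ^ Literature.NumberTheory.Sieve.Shiu.bigOmega n := by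
    refine Literature.NumberTheory.Sieve.Shiu.le_pow_bigOmega (f := fun k => (k.divisors.card : ℝ))
      (fun k => Nat.cast_nonneg _) (by simp) (fun a b hab => by exact_mod_cast hab.card_divisors_mul) ?_ hn
    intro p l hp _
    rw [Nat.divisors_prime_pow hp, Finset.card_map, Finset.card_range]
    exact_mod_cast Nat.succ_le_of_lt Nat.lt_two_pow_self
  have h2 := Literature.NumberTheory.Sieve.Shiu.bigOmega_le_div_log hn hz hr hnY
  calc (n.divisors.card : ℝ) ≤ (2 : ℝ) ^ Literature.NumberTheory.Sieve.Shiu.bigOmega n := h1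
    _ = (2 : ℝ) ^ ((Literature.NumberTheory.Sieve.Shiu.bigOmega n : ℕ) : ℝ) := (Real.rpow_natCast _ _).symm
    _ ≤ (2 : ℝ) ^ (Real.log Y / Real.log z) := Real.rpow_le_rpow_of_exponent_le (by norm_num) h2

/-- A natural number all of whose prime factors are `≥ z > 1` has at most `log d/log z` of them.
[folklore] -/
theorem card_primeFactors_le_log_div' {d : ℕ} (hd : d ≠ 0) {z : ℝ} (hz : 1 < z)
    (hr : ∀ p ∈ d.primeFactors, z ≤ (p : ℝ)) :
    (d.primeFactors.card : ℝ) ≤ Real.log d / Real.log z := by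
  have hz0 : 0 < z := by linarith
  have h1 : z ^ d.primeFactors.card ≤ ∏ p ∈ d.primeFactors, (p : ℝ) := by
    rw [← Finset.prod_const]
    exact Finset.prod_le_prod (fun _ _ => hz0.le) fun p hp => hr p hp
  have h2 : ∏ p ∈ d.primeFactors, (p : ℝ) ≤ d := by
    have h3 : ∏ p ∈ d.primeFactors, p ≤ d :=
      Nat.le_of_dvd (Nat.pos_of_ne_zero hd) (Nat.prod_primeFactors_dvd d)
    have h4 : ((∏ p ∈ d.primeFactors, p : ℕ) : ℝ) ≤ d := by exact_mod_cast h3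
    rwa [Nat.cast_prod] at h4
  have h5 := Real.log_le_log (by positivity) (h1.trans h2)
  rw [Real.log_pow] at h5
  rw [le_div_iff₀ (Real.log_pos hz)]
  exact h5

/-! ### `λ = 1 ∗ χ` on square-free numbers: support on products of exceptional primes -/

variable {q : ℕ} [NeZero q] (χ : DirichletCharacter ℂ q)

/-- For square-free `e` and quadratic `χ`: `λ(e) = ∏_{p ∣ e} (1 + χ(p)) ≤ 2^{ω(e)} · 1[χ(p) ≠ −1 ∀ p ∣ e]`.
[cite: MatomakiMerikoski2023, §4 (proof of Lemma 2.2)] -/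
theorem oneConvChi_le_of_squarefree (hχ : χ ^ 2 = 1) {e : ℕ} (he : Squarefree e) :
    oneConvChi χ e ≤ if ∀ p ∈ e.primeFactors, DirichletAbel.reChar χ p ≠ -1 then (2 : ℝ) ^ e.primeFactors.card else 0 := by
  rw [oneConvChi_eq_charDivisorSum χ hχ, ← (RealChar.isMultiplicative_charDivisorSum χ hχ).prod_primeFactors he]
  have hfac : ∀ p ∈ e.primeFactors, RealChar.charDivisorSum χ p = 1 + DirichletAbel.reChar χ p := fun p hp =>
    RealChar.charDivisorSum_prime χ hχ (Nat.prime_of_mem_primeFactors hp)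
  rw [Finset.prod_congr rfl hfac]
  have hbd : ∀ p ∈ e.primeFactors, 0 ≤ 1 + DirichletAbel.reChar χ p ∧ 1 + DirichletAbel.reChar χ p ≤ 2 := by
    intro p hp
    have := DirichletAbel.abs_reChar_le_one χ p
    rw [abs_le] at this
    constructor <;> linarith
  split_ifs with hall
  · rw [← Finset.prod_const]
    exact Finset.prod_le_prod (fun p hp => (hbd p hp).1) fun p hp => (hbd p hp).2
  · push Not at hall
    obtain ⟨p, hp, hpm⟩ := hall
    rw [Finset.prod_eq_zero hp (by rw [hpm]; norm_num)]

/-- **The structure of `c_m` on square-free `m`.** For square-free `m ≠ 0` and quadratic `χ`,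
`c_m = λ'(m) − Λ(m) ≤ log m · ∑_{p ∣ m} W(m/p)`, `W(e) = 2^{ω(e)} 1[e > 1, every prime factor of e exceptional]`
(`c_m = ∑_{m = dk, d > 1} λ(d)Λ(k)`, `Λ(k) ≠ 0` forces `k = p` prime, and `λ(m/p)` vanishes unless `m/p` is
composed of exceptional primes). [cite: MatomakiMerikoski2023, §2 (2.5) and §4] -/
theorem charLog_sub_vonMangoldt_le_of_squarefree (hχ : χ ^ 2 = 1) {m : ℕ} (hm : m ≠ 0) (hsq : Squarefree m) :
    charLog χ m - Λ m ≤ Real.log m * ∑ p ∈ m.primeFactors,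
      (if 1 < m / p ∧ ∀ p' ∈ (m / p).primeFactors, DirichletAbel.reChar χ p' ≠ -1
        then (2 : ℝ) ^ (m / p).primeFactors.card else 0) := by
  classical
  rw [charLog_sub_vonMangoldt χ hm]
  -- rewrite over all divisors with the indicator of `d ≠ 1`, then `d ↦ m/d`
  set F : ℕ → ℝ := fun d => if d = 1 then 0 else oneConvChi χ d * Λ (m / d) with hF
  have h1 : ∑ d ∈ m.divisors.erase 1, oneConvChi χ d * Λ (m / d) = ∑ d ∈ m.divisors, F d := by
    rw [← Finset.sum_erase_add _ _ (Nat.one_mem_divisors.mpr hm)]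
    simp only [hF, if_true, add_zero]
    exact Finset.sum_congr rfl fun d hd => by rw [if_neg (Finset.ne_of_mem_erase hd)]
  have h2 : ∑ d ∈ m.divisors, F d = ∑ d ∈ m.divisors, F (m / d) := (Nat.sum_div_divisors m F).symm
  rw [h1, h2, Finset.mul_sum]
  -- compare termwise with the sum over prime divisors
  have hlam0 : ∀ d, 0 ≤ oneConvChi χ d := fun d => by
    rw [oneConvChi_eq_charDivisorSum χ hχ]; exact RealChar.charDivisorSum_nonneg χ hχ d
  have hterm : ∀ d ∈ m.divisors, F (m / d) ≤
      if d.Prime then Real.log m * (if 1 < m / d ∧ ∀ p' ∈ (m / d).primeFactors, DirichletAbel.reChar χ p' ≠ -1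
        then (2 : ℝ) ^ (m / d).primeFactors.card else 0) else 0 := by
    intro d hd
    have hdm : d ∣ m := Nat.dvd_of_mem_divisors hd
    have hd0 : d ≠ 0 := Nat.ne_of_gt (Nat.pos_of_mem_divisors hd)
    have hmdd : m / d * d = m := Nat.div_mul_cancel hdm
    have hdiv : m / (m / d) = d := Nat.div_div_self hdm hm
    simp only [hF, hdiv]
    by_cases hmd1 : m / d = 1
    · rw [if_pos hmd1]; split_ifs <;> positivity
    rw [if_neg hmd1]
    by_cases hdp : d.Prime
    · rw [if_pos hdp, ArithmeticFunction.vonMangoldt_apply_prime hdp]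
      have hlogd : Real.log d ≤ Real.log m :=
        Real.log_le_log (by exact_mod_cast hdp.pos) (by exact_mod_cast Nat.le_of_dvd (Nat.pos_of_ne_zero hm) hdm)
      have hlogd0 : 0 ≤ Real.log d := Real.log_nonneg (by exact_mod_cast hdp.one_lt.le)
      have hsq' : Squarefree (m / d) := hsq.squarefree_of_dvd (Nat.div_dvd_of_dvd hdm)
      have hlt : 1 < m / d := by
        have h0 : m / d ≠ 0 := fun h0 => hm (by rw [← hmdd, h0, zero_mul])
        rcases Nat.lt_or_ge 1 (m / d) with h | h
        · exact h
        · exfalso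
          interval_cases hmd : (m / d)
          · exact h0 rfl
          · exact hmd1 rfl
      have hW := oneConvChi_le_of_squarefree χ hχ hsq'
      calc oneConvChi χ (m / d) * Real.log d ≤
          (if ∀ p' ∈ (m / d).primeFactors, DirichletAbel.reChar χ p' ≠ -1 then (2 : ℝ) ^ (m / d).primeFactors.card else 0) *
            Real.log m := mul_le_mul hW hlogd hlogd0 (by split_ifs <;> positivity)
        _ = _ := by
          rw [mul_comm]
          congr 1
          by_cases hall : ∀ p' ∈ (m / d).primeFactors, DirichletAbel.reChar χ p' ≠ -1
          · rw [if_pos hall, if_pos ⟨hlt, hall⟩]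
          · rw [if_neg hall, if_neg (fun h' => hall h'.2)]
    · -- `d` not prime: `Λ(d) = 0` unless `d` is a prime power `p^k`, `k ≥ 2`, impossible for square-free `m`
      rw [if_neg hdp]
      have hΛ : Λ d = 0 := by
        rw [ArithmeticFunction.vonMangoldt_eq_zero_iff]
        intro hpow
        rw [isPrimePow_nat_iff] at hpow
        obtain ⟨p, k, hp, hk, rfl⟩ := hpow
        have hk1 : k ≠ 1 := fun h1 => hdp (by rw [h1, pow_one]; exact hp)
        have hk2 : 2 ≤ k := by omega
        have hp2 : p ^ 2 ∣ m := (pow_dvd_pow p hk2).trans hdm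
        rw [pow_two] at hp2
        exact hp.one_lt.ne' (Nat.isUnit_iff.mp (hsq p hp2))
      rw [hΛ, mul_zero]
  refine (Finset.sum_le_sum hterm).trans (le_of_eq ?_)
  rw [← Finset.sum_filter, ← Nat.primeFactors_eq_to_filter_divisors_prime]


/-! ### The count: `n ≤ N` rough with `n + h = pe`, `p` prime, by the pair sieve, uniformly in `e` -/

/-- The determinant of the pair `(k + h, ek + (e−1)h)` is `h`. [folklore] -/
theorem det_one_shift (h e : ℕ) (he : 1 ≤ e) : PairLinearSieve.det 1 h e ((e - 1) * h) = h := by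
  unfold PairLinearSieve.det
  have : ((((e - 1) * h : ℕ)) : ℤ) = ((e : ℤ) - 1) * h := by push_cast [Nat.cast_sub he]; ring
  rw [this]
  have : (1 : ℤ) * (((e : ℤ) - 1) * h) - (e : ℤ) * (h : ℤ) = -(h : ℤ) := by ring
  rw [show ((1 : ℕ) : ℤ) = 1 from rfl] at *
  rw [this, Int.natAbs_neg, Int.natAbs_natCast]

/-- The determinant of the pair of forms `(k + (m₀ + 1), ek + (e − r))`, `h = e m₀ + r`, `0 ≤ r < e`:
`|1·(e − r) − e(m₀ + 1)| = h`. [folklore] -/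
theorem det_shift_param (h e : ℕ) (he : 1 ≤ e) :
    PairLinearSieve.det 1 (h / e + 1) e (e - h % e) = h := by
  have hr : h % e < e := Nat.mod_lt h (by omega)
  have hdiv : e * (h / e) + h % e = h := Nat.div_add_mod h e
  generalize h / e = a at hdiv ⊢
  generalize h % e = b at hr hdiv ⊢
  subst hdiv
  unfold PairLinearSieve.det
  have hcast : ((e - b : ℕ) : ℤ) = (e : ℤ) - (b : ℤ) := by exact_mod_cast Int.natCast_sub hr.le
  rw [hcast]
  have key : ((1 : ℕ) : ℤ) * ((e : ℤ) - (b : ℤ)) - (e : ℤ) * ((a + 1 : ℕ) : ℤ) = -((e * a + b : ℕ) : ℤ) := by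
    push_cast; ring
  rw [key, Int.natAbs_neg, Int.natAbs_natCast]

/-- `√z ≤ 16 z/log² z` and `1 ≤ 8 z/log² z` for `z ≥ 4` (`log z ≤ 4 z^{1/4}`). [folklore] -/
theorem sqrt_le_div_log_sq {z : ℝ} (hz : 4 ≤ z) :
    Real.sqrt z ≤ 16 * (z / Real.log z ^ 2) ∧ (1 : ℝ) ≤ 8 * (z / Real.log z ^ 2) := by
  have hz0 : 0 < z := by linarith
  have hlogz : 0 < Real.log z := Real.log_pos (by linarith)
  have hl : Real.log z ≤ z ^ (1 / 4 : ℝ) / (1 / 4) := Real.log_le_rpow_div hz0.le (by norm_num)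
  have hq0 : 0 ≤ z ^ (1 / 4 : ℝ) := Real.rpow_nonneg hz0.le _
  have hsq : (z ^ (1 / 4 : ℝ)) ^ 2 = Real.sqrt z := by
    rw [← Real.rpow_natCast, ← Real.rpow_mul hz0.le, Real.sqrt_eq_rpow]; norm_num
  have hlog2 : Real.log z ^ 2 ≤ 16 * Real.sqrt z := by
    have h1 : Real.log z ≤ 4 * z ^ (1 / 4 : ℝ) := by linarith
    calc Real.log z ^ 2 ≤ (4 * z ^ (1 / 4 : ℝ)) ^ 2 := pow_le_pow_left₀ hlogz.le h1 2
      _ = 16 * Real.sqrt z := by rw [mul_pow, hsq]; norm_num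
  have hsz : Real.sqrt z * Real.sqrt z = z := Real.mul_self_sqrt hz0.le
  have hs2 : 2 ≤ Real.sqrt z := by
    rw [show (2 : ℝ) = Real.sqrt 4 by rw [show (4:ℝ) = 2 ^ 2 by norm_num, Real.sqrt_sq (by norm_num)]]
    exact Real.sqrt_le_sqrt hz
  have hl2pos : 0 < Real.log z ^ 2 := by positivity
  constructor
  · rw [mul_div_assoc', le_div_iff₀ hl2pos]
    calc Real.sqrt z * Real.log z ^ 2 ≤ Real.sqrt z * (16 * Real.sqrt z) :=
          mul_le_mul_of_nonneg_left hlog2 (Real.sqrt_nonneg z)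
      _ = 16 * (Real.sqrt z * Real.sqrt z) := by ring
      _ = 16 * z := by rw [hsz]
  · rw [mul_div_assoc', le_div_iff₀ hl2pos, one_mul]
    calc Real.log z ^ 2 ≤ 16 * Real.sqrt z := hlog2
      _ ≤ 8 * (Real.sqrt z * Real.sqrt z) := by nlinarith
      _ = 8 * z := by rw [hsz]

/-- **The pair-sieve count, uniform in `e` and in `h`.** There is an absolute `C > 0` such that for all
`N h e ∈ ℕ`, real `z` with `1 ≤ h`, `1 ≤ e`, `4 ≤ z`, `ez ≤ N + h`:
`#{1 ≤ n ≤ N : n z-rough, e ∣ n + h, (n+h)/e a prime ≥ z} ≤ C (eh/φ(eh)) ((N+h)/e)/log² z`.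
Writing `h = e m₀ + r` (`0 ≤ r < e`) and `(n + h)/e = m = k + m₀ + 1`, the pair `(m, n)` is the pair of
linear forms `(k + (m₀ + 1), ek + (e − r))` in `k ≥ 0`, of determinant `h` (`det_shift_param`); the `k ≥ 1`
are counted by the tree's `PairLinearSieve.card_sifted_le`, sifted to `w = z/2` when the range `K` of `k`
is `≥ z/2`, to `w = K` when `√z ≤ K < z/2`, and trivially when `K < √z ≤ 16 z/log² z`; `k = 0` is one
value. (No hypothesis `h < z`: the source's Lemma 2.1 is used for all `h ≤ X^{1+ε}` in §7.)
[cite: MatomakiMerikoski2023, Lemma 2.1 (proof)] -/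
theorem card_rough_shift_eq_prime_mul_le : ∃ C : ℝ, 0 < C ∧ ∀ (N h e : ℕ) (z : ℝ), 1 ≤ h → 1 ≤ e →
    4 ≤ z → (e : ℝ) * z ≤ (N : ℝ) + h →
      (#((Icc 1 N).filter (fun n : ℕ => (∀ p ∈ n.primeFactors, z ≤ (p : ℝ)) ∧ e ∣ n + h ∧
          ((n + h) / e).Prime ∧ z ≤ (((n + h) / e : ℕ) : ℝ))) : ℝ) ≤
        C * ((((e * h : ℕ)) : ℝ) / Nat.totient (e * h)) * (((N : ℝ) + h) / e) / Real.log z ^ 2 := by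
  obtain ⟨C, hC, HS⟩ := PairLinearSieve.card_sifted_le
  refine ⟨4 * C + 24, by positivity, ?_⟩
  intro N h e z hh he hz hez
  classical
  set S := (Icc 1 N).filter (fun n : ℕ => (∀ p ∈ n.primeFactors, z ≤ (p : ℝ)) ∧ e ∣ n + h ∧
      ((n + h) / e).Prime ∧ z ≤ (((n + h) / e : ℕ) : ℝ)) with hS
  -- sizes
  have he0 : (0 : ℝ) < e := by exact_mod_cast (show 0 < e by omega)
  have hz0 : 0 < z := by linarith
  have hlogz : 0 < Real.log z := Real.log_pos (by linarith)
  have hl2pos : 0 < Real.log z ^ 2 := by positivity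
  set M : ℝ := ((N : ℝ) + h) / e with hM
  have hzM : z ≤ M := by rw [hM, le_div_iff₀ he0, mul_comm]; exact hez
  have hM0 : 0 < M := lt_of_lt_of_le hz0 hzM
  set F : ℝ := (((e * h : ℕ)) : ℝ) / Nat.totient (e * h) with hF
  have heh0 : e * h ≠ 0 := Nat.mul_ne_zero (by omega) (by omega)
  have hφ0 : (0 : ℝ) < Nat.totient (e * h) := by exact_mod_cast Nat.totient_pos.mpr (Nat.pos_of_ne_zero heh0)
  have hF1 : 1 ≤ F := by
    rw [hF, le_div_iff₀ hφ0, one_mul]; exact_mod_cast Nat.totient_le (e * h)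
  have hF0 : 0 ≤ F := by linarith
  obtain ⟨hsqrt16, hone8⟩ := sqrt_le_div_log_sq hz
  -- the parameters `m₀ = h / e`, `r = h % e`
  set m₀ : ℕ := h / e with hm₀
  set r : ℕ := h % e with hr_def
  have hr : r < e := Nat.mod_lt h (by omega)
  have hher : e * m₀ + r = h := Nat.div_add_mod h e
  set L : ℕ := ⌊M⌋₊ with hL
  set K : ℕ := L - (m₀ + 1) with hK
  have hKM : (K : ℝ) ≤ M := by
    calc (K : ℝ) ≤ L := by exact_mod_cast Nat.sub_le L (m₀ + 1)
      _ ≤ M := Nat.floor_le hM0.le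
  -- facts about the elements of `S`
  have hfacts : ∀ n ∈ S, 1 ≤ n ∧ e * ((n + h) / e) = n + h ∧ m₀ + 1 ≤ (n + h) / e ∧ (n + h) / e ≤ L ∧
      (∀ p ∈ n.primeFactors, z ≤ (p : ℝ)) ∧ ((n + h) / e).Prime := by
    intro n hn
    rw [hS, Finset.mem_filter, Finset.mem_Icc] at hn
    obtain ⟨⟨hn1, hnN⟩, hrough, hediv, hprime, hpz⟩ := hn
    have hmul : e * ((n + h) / e) = n + h := Nat.mul_div_cancel' hediv
    refine ⟨hn1, hmul, ?_, ?_, hrough, hprime⟩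
    · -- `e (m₀ + 1) ≤ ... `: `e * m ≥ h + 1 > e m₀`
      by_contra hlt
      push Not at hlt
      have : e * ((n + h) / e) ≤ e * m₀ := Nat.mul_le_mul_left e (by omega)
      omega
    · refine Nat.le_floor ?_
      rw [hM, le_div_iff₀ he0]
      have : (((n + h) / e : ℕ) : ℝ) * e = ((n + h : ℕ) : ℝ) := by
        rw [mul_comm]; exact_mod_cast hmul
      rw [this]; push_cast
      have : (n : ℝ) ≤ N := by exact_mod_cast hnN
      linarith
  -- `n` is determined by `m = (n + h)/e`
  have hinjm : Set.InjOn (fun n : ℕ => (n + h) / e) S := by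
    intro n₁ hn₁ n₂ hn₂ heq
    have h1 := (hfacts n₁ hn₁).2.1
    have h2 := (hfacts n₂ hn₂).2.1
    simp only at heq
    rw [heq] at h1
    omega
  -- split `S` according to `m = m₀ + 1` or `m ≥ m₀ + 2`
  set S₀ := S.filter (fun n => (n + h) / e = m₀ + 1) with hS₀
  set S₁ := S.filter (fun n => m₀ + 2 ≤ (n + h) / e) with hS₁
  have hsplit : S ⊆ S₀ ∪ S₁ := by
    intro n hn
    have h3 := (hfacts n hn).2.2.1
    by_cases hcase : (n + h) / e = m₀ + 1
    · exact Finset.mem_union.mpr (Or.inl (Finset.mem_filter.mpr ⟨hn, hcase⟩))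
    · exact Finset.mem_union.mpr (Or.inr (Finset.mem_filter.mpr ⟨hn, by omega⟩))
  have hS₀card : #S₀ ≤ 1 := by
    refine Finset.card_le_one.mpr fun n₁ hn₁ n₂ hn₂ => ?_
    obtain ⟨h1S, h1m⟩ := Finset.mem_filter.mp hn₁
    obtain ⟨h2S, h2m⟩ := Finset.mem_filter.mp hn₂
    refine hinjm h1S h2S ?_
    simp only
    rw [h1m, h2m]
  -- the sieve set
  have hdet : PairLinearSieve.det 1 (m₀ + 1) e (e - r) = h := by
    rw [hm₀, hr_def]; exact det_shift_param h e he
  have hdet0 : PairLinearSieve.det 1 (m₀ + 1) e (e - r) ≠ 0 := by rw [hdet]; omega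
  have hT_of : ∀ w : ℝ, w ≤ z →
      (#S₁ : ℝ) ≤ #((Icc 1 K).filter (fun k : ℕ => (∀ p ∈ (1 * k + (m₀ + 1)).primeFactors, w ≤ (p : ℝ)) ∧
          (∀ p ∈ (e * k + (e - r)).primeFactors, w ≤ (p : ℝ) ∨ p ∣ e * PairLinearSieve.det 1 (m₀ + 1) e (e - r)))) := by
    intro w hwz
    set T := (Icc 1 K).filter (fun k : ℕ => (∀ p ∈ (1 * k + (m₀ + 1)).primeFactors, w ≤ (p : ℝ)) ∧
          (∀ p ∈ (e * k + (e - r)).primeFactors, w ≤ (p : ℝ) ∨ p ∣ e * PairLinearSieve.det 1 (m₀ + 1) e (e - r)))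
      with hT
    have hmap : ∀ n ∈ S₁, (n + h) / e - (m₀ + 1) ∈ T := by
      intro n hn
      obtain ⟨hnS, hm2⟩ := Finset.mem_filter.mp hn
      obtain ⟨hn1, hmul, hm1, hmL, hrough, hprime⟩ := hfacts n hnS
      have hpz : z ≤ (((n + h) / e : ℕ) : ℝ) := (Finset.mem_filter.mp hnS).2.2.2.2
      set m := (n + h) / e with hm
      rw [hT, Finset.mem_filter, Finset.mem_Icc]
      refine ⟨⟨by omega, by rw [hK]; omega⟩, ?_, ?_⟩
      · intro p hp
        rw [one_mul, show m - (m₀ + 1) + (m₀ + 1) = m by omega, hprime.primeFactors,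
          Finset.mem_singleton] at hp
        rw [hp]
        exact hwz.trans hpz
      · intro p hp
        left
        have hid : e * (m - (m₀ + 1)) + (e - r) = n := by
          zify [hm1, hr.le, show h ≤ n + h from Nat.le_add_left h n] at hmul hher ⊢
          linear_combination hmul - hher
        rw [hid] at hp
        exact hwz.trans (hrough p hp)
    have hinj : Set.InjOn (fun n : ℕ => (n + h) / e - (m₀ + 1)) S₁ := by
      intro n₁ hn₁ n₂ hn₂ heq
      have hn₁' := (Finset.mem_filter.mp (Finset.mem_coe.mp hn₁)).1
      have hn₂' := (Finset.mem_filter.mp (Finset.mem_coe.mp hn₂)).1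
      have h1 := (hfacts n₁ hn₁').2.2.1
      have h2 := (hfacts n₂ hn₂').2.2.1
      refine hinjm hn₁' hn₂' ?_
      simp only at heq ⊢
      omega
    have hcard : #S₁ ≤ #T := Finset.card_le_card_of_injOn _ hmap hinj
    exact_mod_cast hcard
  -- the bound for `S₁`: three regimes
  have hS₁bound : (#S₁ : ℝ) ≤ (4 * C + 16) * F * M / Real.log z ^ 2 := by
    by_cases hK1 : z / 2 ≤ K
    · -- sieve to `w = z/2`
      set w : ℝ := z / 2 with hw
      have hw2 : 2 ≤ w := by rw [hw]; linarith
      have hwK : w ≤ K := hK1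
      have hsieve := HS K 1 (m₀ + 1) e (e - r) le_rfl he hdet0 w w hw2 hwK hw2 hwK
      have hlogw : Real.log z / 2 ≤ Real.log w := by
        rw [hw, Real.log_div (by linarith) (by norm_num)]
        have : Real.log 2 ≤ Real.log z / 2 := by
          have h4 : Real.log 4 = 2 * Real.log 2 := by
            rw [show (4 : ℝ) = 2 ^ 2 by norm_num, Real.log_pow]; ring
          have := Real.log_le_log (by norm_num) hz
          linarith
        linarith
      have hlogw0 : 0 < Real.log w := by linarith
      calc (#S₁ : ℝ) ≤ _ := hT_of w (by rw [hw]; linarith)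
        _ ≤ C * ((1 : ℕ) / Nat.totient 1) * ((((e * PairLinearSieve.det 1 (m₀ + 1) e (e - r) : ℕ)) : ℝ) /
              Nat.totient (e * PairLinearSieve.det 1 (m₀ + 1) e (e - r))) * K / (Real.log w * Real.log w) := hsieve
        _ = C * F * K / Real.log w ^ 2 := by rw [hdet, Nat.totient_one, hF]; push_cast; ring
        _ ≤ C * F * M / (Real.log z / 2) ^ 2 := by gcongr
        _ = 4 * C * F * M / Real.log z ^ 2 := by field_simp; ring
        _ ≤ (4 * C + 16) * F * M / Real.log z ^ 2 := by
            refine div_le_div_of_nonneg_right ?_ hl2pos.le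
            have : 0 ≤ 16 * F * M := by positivity
            nlinarith
    · push Not at hK1
      by_cases hK2 : Real.sqrt z ≤ K
      · -- sieve to `w = K`
        set w : ℝ := (K : ℝ) with hw
        have hs2 : 2 ≤ Real.sqrt z := by
          rw [show (2 : ℝ) = Real.sqrt 4 by rw [show (4:ℝ) = 2 ^ 2 by norm_num, Real.sqrt_sq (by norm_num)]]
          exact Real.sqrt_le_sqrt hz
        have hw2 : 2 ≤ w := hs2.trans hK2
        have hsieve := HS K 1 (m₀ + 1) e (e - r) le_rfl he hdet0 w w hw2 le_rfl hw2 le_rfl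
        have hlogw : Real.log z / 2 ≤ Real.log w := by
          have h1 : Real.log (Real.sqrt z) = Real.log z / 2 := Real.log_sqrt hz0.le
          rw [← h1]
          exact Real.log_le_log (by linarith) hK2
        have hlogw0 : 0 < Real.log w := by linarith
        calc (#S₁ : ℝ) ≤ _ := hT_of w (by rw [hw]; linarith)
          _ ≤ C * ((1 : ℕ) / Nat.totient 1) * ((((e * PairLinearSieve.det 1 (m₀ + 1) e (e - r) : ℕ)) : ℝ) /
                Nat.totient (e * PairLinearSieve.det 1 (m₀ + 1) e (e - r))) * K / (Real.log w * Real.log w) := hsieve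
          _ = C * F * K / Real.log w ^ 2 := by rw [hdet, Nat.totient_one, hF]; push_cast; ring
          _ ≤ C * F * M / (Real.log z / 2) ^ 2 := by gcongr
          _ = 4 * C * F * M / Real.log z ^ 2 := by field_simp; ring
          _ ≤ (4 * C + 16) * F * M / Real.log z ^ 2 := by
              refine div_le_div_of_nonneg_right ?_ hl2pos.le
              have : 0 ≤ 16 * F * M := by positivity
              nlinarith
      · -- trivial: `#S₁ ≤ K < √z ≤ 16 z/log² z`
        push Not at hK2
        have h1 : (#S₁ : ℝ) ≤ K := by
          calc (#S₁ : ℝ) ≤ _ := hT_of z le_rfl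
            _ ≤ #(Icc 1 K) := by exact_mod_cast Finset.card_filter_le _ _
            _ = K := by simp
        calc (#S₁ : ℝ) ≤ K := h1
          _ ≤ Real.sqrt z := hK2.le
          _ ≤ 16 * (z / Real.log z ^ 2) := hsqrt16
          _ ≤ 16 * (M / Real.log z ^ 2) := by gcongr
          _ = 16 * 1 * M / Real.log z ^ 2 := by ring
          _ ≤ (4 * C + 16) * F * M / Real.log z ^ 2 := by
              refine div_le_div_of_nonneg_right ?_ hl2pos.le
              refine mul_le_mul (mul_le_mul (by linarith) hF1 zero_le_one (by positivity)) le_rfl hM0.le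
                (by positivity)
  -- assemble
  have hS0' : (#S₀ : ℝ) ≤ 8 * F * M / Real.log z ^ 2 := by
    calc (#S₀ : ℝ) ≤ 1 := by exact_mod_cast hS₀card
      _ ≤ 8 * (z / Real.log z ^ 2) := hone8
      _ ≤ 8 * (M / Real.log z ^ 2) := by gcongr
      _ = 8 * 1 * M / Real.log z ^ 2 := by ring
      _ ≤ 8 * F * M / Real.log z ^ 2 := by
          refine div_le_div_of_nonneg_right ?_ hl2pos.le
          exact mul_le_mul_of_nonneg_right (mul_le_mul_of_nonneg_left hF1 (by norm_num)) hM0.le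
  calc (#S : ℝ) ≤ #(S₀ ∪ S₁) := by exact_mod_cast Finset.card_le_card hsplit
    _ ≤ #S₀ + #S₁ := by exact_mod_cast Finset.card_union_le _ _
    _ ≤ 8 * F * M / Real.log z ^ 2 + (4 * C + 16) * F * M / Real.log z ^ 2 := add_le_add hS0' hS₁bound
    _ = (4 * C + 24) * F * M / Real.log z ^ 2 := by ring

/-! ### Tails of `∑ 1/k²` -/

/-- `∑_{k ∈ S} 1/k² ≤ 1/(K − 1)` when every element of `S` is `≥ K ≥ 2`. [folklore] -/
theorem sum_inv_sq_tail_le (S : Finset ℕ) {K : ℕ} (hK : 2 ≤ K) (hS : ∀ k ∈ S, K ≤ k) :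
    ∑ k ∈ S, 1 / (k : ℝ) ^ 2 ≤ 1 / ((K : ℝ) - 1) := by
  have hpt : ∀ k : ℕ, 2 ≤ k → 1 / (k : ℝ) ^ 2 ≤ 1 / ((k : ℝ) - 1) - 1 / k := by
    intro k hk
    have hk' : (2 : ℝ) ≤ k := by exact_mod_cast hk
    rw [div_sub_div _ _ (by linarith) (by linarith), div_le_div_iff₀ (by positivity) (by nlinarith)]
    nlinarith
  rcases S.eq_empty_or_nonempty with rfl | hne
  · simp only [Finset.sum_empty]
    have : (2 : ℝ) ≤ K := by exact_mod_cast hK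
    exact div_nonneg zero_le_one (by linarith)
  set M := S.max' hne
  have hKM : K ≤ M := (hS _ (Finset.max'_mem S hne))
  have hsub : S ⊆ Icc K M := fun k hk => Finset.mem_Icc.mpr ⟨hS k hk, Finset.le_max' S k hk⟩
  have htel : ∀ L : ℕ, K ≤ L + 1 → ∑ k ∈ Icc K (L + 1), (1 / ((k : ℝ) - 1) - 1 / k) ≤ 1 / ((K : ℝ) - 1) := by
    intro L
    induction L with
    | zero => intro hK1; omega
    | succ L ih =>
      intro hKL
      rcases Nat.lt_or_ge (L + 1) K with hlt | hge
      · have hKe : K = L + 2 := by omega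
        subst hKe
        rw [show L + 1 + 1 = L + 2 by ring, Finset.Icc_self, Finset.sum_singleton]
        push_cast
        have : (0 : ℝ) ≤ 1 / ((L : ℝ) + 2) := by positivity
        linarith
      · rw [Finset.sum_Icc_succ_top (by omega)]
        have := ih hge
        push_cast
        have h1 : (1 : ℝ) / ((L : ℝ) + 1 + 1 - 1) = 1 / ((L : ℝ) + 1) := by ring_nf
        have h2 : (0 : ℝ) ≤ 1 / ((L : ℝ) + 1 + 1) := by positivity
        have h3 : ∑ k ∈ Icc K (L + 1), (1 / ((k : ℝ) - 1) - 1 / k) ≤ 1 / ((K : ℝ) - 1) := this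
        -- the last term is `1/(L+1) - 1/(L+2) ≤`, and the partial sums telescope to `≤ 1/(K-1) - 1/(L+1)`
        have htel2 : ∀ L' : ℕ, K ≤ L' + 1 → ∑ k ∈ Icc K (L' + 1), (1 / ((k : ℝ) - 1) - 1 / k) = 1 / ((K : ℝ) - 1) - 1 / ((L' : ℝ) + 1) := by
          intro L'
          induction L' with
          | zero => intro h0; have : K = 1 := by omega
                    omega
          | succ L' ih' =>
            intro hKL'
            rcases Nat.lt_or_ge (L' + 1) K with hlt | hge
            · have hKe : K = L' + 2 := by omega
              subst hKe
              rw [show L' + 1 + 1 = L' + 2 by ring, Finset.Icc_self, Finset.sum_singleton]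
              push_cast; ring
            · rw [Finset.sum_Icc_succ_top (by omega), ih' hge]
              push_cast; ring
        rw [htel2 L hge]
        rw [h1]
        have : (1 : ℝ) / ((L : ℝ) + 1 + 1) ≥ 0 := h2
        nlinarith
  rcases Nat.exists_eq_succ_of_ne_zero (show M ≠ 0 by omega) with ⟨L, hL⟩
  calc ∑ k ∈ S, 1 / (k : ℝ) ^ 2 ≤ ∑ k ∈ Icc K M, 1 / (k : ℝ) ^ 2 :=
        Finset.sum_le_sum_of_subset_of_nonneg hsub fun k _ _ => by positivity
    _ ≤ ∑ k ∈ Icc K M, (1 / ((k : ℝ) - 1) - 1 / k) :=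
        Finset.sum_le_sum fun k hk => hpt k (hK.trans (Finset.mem_Icc.mp hk).1)
    _ ≤ 1 / ((K : ℝ) - 1) := by rw [hL]; exact htel L (by omega)


/-! ### Euler products over a set of primes -/

/-- **Rankin-free Euler bound**: if every `y ∈ E` is square-free, `≠ 1`, with all prime factors in the
set of primes `P`, then `∑_{y ∈ E} 2^{ω(y)}/y ≤ ∏_{p ∈ P} (1 + 2/p) − 1`. [folklore] -/
theorem sum_two_pow_div_le_prod_sub_one (P : Finset ℕ) (hP : ∀ p ∈ P, p.Prime) (E : Finset ℕ)
    (hE : ∀ y ∈ E, Squarefree y ∧ y ≠ 1 ∧ y.primeFactors ⊆ P) :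
    ∑ y ∈ E, (2 : ℝ) ^ y.primeFactors.card / y ≤ ∏ p ∈ P, (1 + 2 / (p : ℝ)) - 1 := by
  classical
  set F : ℕ → ℝ := fun y => (2 : ℝ) ^ y.primeFactors.card / y with hF
  set g : Finset ℕ → ℕ := fun T => ∏ p ∈ T, p with hg
  have hF0 : ∀ y, 0 ≤ F y := fun y => by simp only [hF]; positivity
  -- `E` sits inside the image of the non-empty subsets of `P`
  have hsub : E ⊆ (P.powerset.erase ∅).image g := by
    intro y hy
    obtain ⟨hsq, hy1, hyP⟩ := hE y hy
    rw [Finset.mem_image]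
    refine ⟨y.primeFactors, Finset.mem_erase.mpr ⟨?_, Finset.mem_powerset.mpr hyP⟩, ?_⟩
    · rw [Ne, Nat.primeFactors_eq_empty, not_or]; exact ⟨hsq.ne_zero, hy1⟩
    · exact Nat.prod_primeFactors_of_squarefree hsq
  have hinj : Set.InjOn g ((P.powerset.erase ∅ : Finset (Finset ℕ)) : Set (Finset ℕ)) := by
    intro T hT T' hT' heq
    have hTP : ∀ p ∈ T, p.Prime := fun p hp =>
      hP p (Finset.mem_powerset.mp (Finset.mem_erase.mp hT).2 hp)
    have hTP' : ∀ p ∈ T', p.Prime := fun p hp =>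
      hP p (Finset.mem_powerset.mp (Finset.mem_erase.mp hT').2 hp)
    have h1 : (g T).primeFactors = T := Nat.primeFactors_prod hTP
    have h2 : (g T').primeFactors = T' := Nat.primeFactors_prod hTP'
    rw [← h1, ← h2, heq]
  have hFg : ∀ T ∈ P.powerset.erase ∅, F (g T) = ∏ p ∈ T, (2 / (p : ℝ)) := by
    intro T hT
    have hTP : ∀ p ∈ T, p.Prime := fun p hp =>
      hP p (Finset.mem_powerset.mp (Finset.mem_erase.mp hT).2 hp)
    simp only [hF, hg, Nat.primeFactors_prod hTP]
    push_cast
    rw [Finset.prod_div_distrib, Finset.prod_const]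
  calc ∑ y ∈ E, F y ≤ ∑ y ∈ (P.powerset.erase ∅).image g, F y :=
        Finset.sum_le_sum_of_subset_of_nonneg hsub fun y _ _ => hF0 y
    _ = ∑ T ∈ P.powerset.erase ∅, F (g T) := Finset.sum_image hinj
    _ = ∑ T ∈ P.powerset.erase ∅, ∏ p ∈ T, (2 / (p : ℝ)) := Finset.sum_congr rfl hFg
    _ = ∑ T ∈ P.powerset, ∏ p ∈ T, (2 / (p : ℝ)) - 1 := by
        rw [← Finset.sum_erase_add _ _ (Finset.empty_mem_powerset P), Finset.prod_empty]; ring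
    _ = ∏ p ∈ P, (1 + 2 / (p : ℝ)) - 1 := by rw [Finset.prod_one_add]

/-- `∏_{p ∈ P} (1 + 2/p) ≤ exp(2 ∑_{p ∈ P} 1/p)`. [folklore] -/
theorem prod_one_add_two_div_le_exp (P : Finset ℕ) :
    ∏ p ∈ P, (1 + 2 / (p : ℝ)) ≤ Real.exp (2 * ∑ p ∈ P, 1 / (p : ℝ)) := by
  rw [Finset.mul_sum, Real.exp_sum]
  refine Finset.prod_le_prod (fun p _ => by positivity) fun p _ => ?_
  have := Real.add_one_le_exp (2 * (1 / (p : ℝ)))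
  rw [mul_one_div] at this ⊢
  linarith


/-! ### Multiples of `d` in a shifted window -/

/-- `#{1 ≤ n ≤ N : d ∣ n + h} ≤ (N + h)/d + 1`. [folklore] -/
theorem card_filter_dvd_shift_le (N h d : ℕ) (hd : 0 < d) :
    (#((Icc 1 N).filter (fun n : ℕ => d ∣ n + h)) : ℝ) ≤ ((N : ℝ) + h) / d + 1 := by
  classical
  have hinj : Set.InjOn (fun n : ℕ => (n + h) / d) ((Icc 1 N).filter (fun n : ℕ => d ∣ n + h) : Finset ℕ) := by
    intro a ha b hb heq
    rw [Finset.coe_filter, Set.mem_setOf_eq] at ha hb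
    have h1 := Nat.div_mul_cancel ha.2
    have h2 := Nat.div_mul_cancel hb.2
    simp only at heq
    rw [heq] at h1
    omega
  have hmap : ∀ n ∈ (Icc 1 N).filter (fun n : ℕ => d ∣ n + h), (n + h) / d ∈ Finset.range ((N + h) / d + 1) := by
    intro n hn
    rw [Finset.mem_filter, Finset.mem_Icc] at hn
    rw [Finset.mem_range, Nat.lt_add_one_iff]
    exact Nat.div_le_div_right (by omega)
  have hc := Finset.card_le_card_of_injOn _ hmap hinj
  rw [Finset.card_range] at hc
  have h2 : (((N + h) / d : ℕ) : ℝ) ≤ ((N : ℝ) + h) / d := by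
    rw [le_div_iff₀ (by exact_mod_cast hd)]
    exact_mod_cast Nat.div_mul_le_self (N + h) d
  calc (#((Icc 1 N).filter (fun n : ℕ => d ∣ n + h)) : ℝ) ≤ (((N + h) / d + 1 : ℕ) : ℝ) := by exact_mod_cast hc
    _ = (((N + h) / d : ℕ) : ℝ) + 1 := by push_cast; ring
    _ ≤ _ := by linarith

/-! ### The structural bound -/

set_option maxHeartbeats 3200000 in
/-- **The `τ(n) c_{n+h}`-part of Matomäki–Merikoski's Lemma 2.1, structural form (no Siegel zero yet).**
There is an absolute `C > 0` such that for every quadratic `χ (mod q)`, all `N h ∈ ℕ` and real `z` with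
`1 ≤ h`, `4 ≤ z ≤ N`, writing `M = N + h`, "adm" for the `1 ≤ n ≤ N` all of whose prime factors and all
prime factors of `n + h` are `≥ z` and coprime to `q`, `c = λ' − Λ`, and `S = ∑_{z ≤ p ≤ M, χ(p) ≠ −1} 1/p`:
`∑_{adm} τ(n) c_{n+h} ≤ C (h/φ(h)) 2^{log N/log z} e^{(log M/log z)/(z−1)} (M log M/log² z) (e^{2S} − 1)`
`+ C 4^{log M/log z} log M (M/(z−1) + √M + 1)`.
[cite: MatomakiMerikoski2023, Lemma 2.1] -/
theorem sum_adm_tau_mul_charLog_sub_vonMangoldt_shift_le :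
    ∃ C : ℝ, 0 < C ∧ ∀ (q : ℕ) [NeZero q] (χ : DirichletCharacter ℂ q), χ ^ 2 = 1 →
      ∀ (N h : ℕ) (z : ℝ), 1 ≤ h → 4 ≤ z → z ≤ N →
        ∑ n ∈ (Icc 1 N).filter (fun n : ℕ =>
            (∀ p ∈ n.primeFactors, z ≤ (p : ℝ) ∧ ¬ p ∣ q) ∧
              (∀ p ∈ (n + h).primeFactors, z ≤ (p : ℝ) ∧ ¬ p ∣ q)),
            (n.divisors.card : ℝ) * (charLog χ (n + h) - Λ (n + h)) ≤
          C * ((h : ℝ) / Nat.totient h) * (2 : ℝ) ^ (Real.log N / Real.log z) *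
              Real.exp ((Real.log ((N : ℝ) + h) / Real.log z) / (z - 1)) *
              (((N : ℝ) + h) * Real.log ((N : ℝ) + h) / Real.log z ^ 2) *
              (Real.exp (2 * ∑ p ∈ SiegelZero.excPrimes χ (Icc ⌈z⌉₊ (N + h)), 1 / (p : ℝ)) - 1) +
            C * (4 : ℝ) ^ (Real.log ((N : ℝ) + h) / Real.log z) * Real.log ((N : ℝ) + h) *
              (((N : ℝ) + h) / (z - 1) + Real.sqrt ((N : ℝ) + h) + 1) := by
  obtain ⟨C₁, hC₁, HC⟩ := card_rough_shift_eq_prime_mul_le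
  refine ⟨max C₁ 1, by positivity, ?_⟩
  intro q _ χ hχ N h z hh hz hzN
  classical
  have hquad : χ.IsQuadratic := MulChar.isQuadratic_iff_sq_eq_one.mpr hχ
  -- names
  set M : ℕ := N + h with hM
  have hMr : (M : ℝ) = (N : ℝ) + h := by rw [hM]; push_cast; ring
  set u₁ : ℝ := Real.log N / Real.log z with hu₁
  set u₂ : ℝ := Real.log ((N : ℝ) + h) / Real.log z with hu₂
  set T₁ : ℝ := (2 : ℝ) ^ u₁ with hT₁
  set T₂ : ℝ := (2 : ℝ) ^ u₂ with hT₂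
  set F : ℝ := (h : ℝ) / Nat.totient h with hF
  set P := SiegelZero.excPrimes χ (Icc ⌈z⌉₊ M) with hP
  set S : ℝ := ∑ p ∈ P, 1 / (p : ℝ) with hS
  set A := (Icc 1 N).filter (fun n : ℕ => (∀ p ∈ n.primeFactors, z ≤ (p : ℝ) ∧ ¬ p ∣ q) ∧
      (∀ p ∈ (n + h).primeFactors, z ≤ (p : ℝ) ∧ ¬ p ∣ q)) with hA
  set W : ℕ → ℝ := fun e => if 1 < e ∧ ∀ p' ∈ e.primeFactors, DirichletAbel.reChar χ p' ≠ -1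
      then (2 : ℝ) ^ e.primeFactors.card else 0 with hW
  -- basic facts
  have hz1 : 1 < z := by linarith
  have hz0 : 0 < z := by linarith
  have hlogz : 0 < Real.log z := Real.log_pos hz1
  have hN1 : (1 : ℝ) ≤ N := by linarith
  have hNpos : (0 : ℝ) < N := by linarith
  have hMpos : (0 : ℝ) < (N : ℝ) + h := by positivity
  have hh1 : (1 : ℝ) ≤ h := by exact_mod_cast hh
  have hM1 : (1 : ℝ) < (N : ℝ) + h := by linarith
  have hlogM : 0 < Real.log ((N : ℝ) + h) := Real.log_pos hM1
  have hlogN0 : 0 ≤ Real.log N := Real.log_nonneg hN1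
  have hu₁0 : 0 ≤ u₁ := div_nonneg hlogN0 hlogz.le
  have hu₂0 : 0 ≤ u₂ := div_nonneg hlogM.le hlogz.le
  have hu₁₂ : u₁ ≤ u₂ := div_le_div_of_nonneg_right (Real.log_le_log hNpos (by linarith)) hlogz.le
  have hT₁1 : 1 ≤ T₁ := Real.one_le_rpow (by norm_num) hu₁0
  have hT₂1 : 1 ≤ T₂ := Real.one_le_rpow (by norm_num) hu₂0
  have hT₁₂ : T₁ ≤ T₂ := Real.rpow_le_rpow_of_exponent_le (by norm_num) hu₁₂
  have hT4 : T₁ * T₂ ≤ (4 : ℝ) ^ u₂ := by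
    calc T₁ * T₂ ≤ T₂ * T₂ := mul_le_mul_of_nonneg_right hT₁₂ (by positivity)
      _ = (4 : ℝ) ^ u₂ := by
          rw [hT₂, ← Real.rpow_add (by norm_num), ← two_mul, Real.rpow_mul (by norm_num)]
          norm_num
  have hF1 : 1 ≤ F := by
    have hφ : (0 : ℝ) < Nat.totient h := by exact_mod_cast Nat.totient_pos.mpr (by omega)
    rw [hF, le_div_iff₀ hφ, one_mul]
    exact_mod_cast Nat.totient_le h
  have hW0 : ∀ e, 0 ≤ W e := fun e => by simp only [hW]; split_ifs <;> positivity
  -- facts about admissible `n`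
  have hmemA : ∀ n ∈ A, 1 ≤ n ∧ n ≤ N ∧ (∀ p ∈ n.primeFactors, z ≤ (p : ℝ)) ∧
      (∀ p ∈ (n + h).primeFactors, z ≤ (p : ℝ) ∧ ¬ p ∣ q) := by
    intro n hn
    rw [hA, Finset.mem_filter, Finset.mem_Icc] at hn
    exact ⟨hn.1.1, hn.1.2, fun p hp => (hn.2.1 p hp).1, hn.2.2⟩
  have hτn : ∀ n ∈ A, (n.divisors.card : ℝ) ≤ T₁ := by
    intro n hn
    obtain ⟨hn1, hnN, hr, -⟩ := hmemA n hn
    exact card_divisors_le_two_rpow_of_rough (by omega) hz1 hr (by exact_mod_cast hnN)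
  have hτm : ∀ n ∈ A, ((n + h).divisors.card : ℝ) ≤ T₂ := by
    intro n hn
    obtain ⟨hn1, hnN, -, hr⟩ := hmemA n hn
    refine card_divisors_le_two_rpow_of_rough (by omega) hz1 (fun p hp => (hr p hp).1) ?_
    have : (n : ℝ) ≤ N := by exact_mod_cast hnN
    push_cast; linarith
  have hc0 : ∀ n ∈ A, 0 ≤ charLog χ (n + h) - Λ (n + h) := fun n hn =>
    (charLog_sub_vonMangoldt_bounds χ hquad (show n + h ≠ 0 by have := (hmemA n hn).1; omega)).1
  have hcle : ∀ n ∈ A, charLog χ (n + h) - Λ (n + h) ≤ T₂ * Real.log ((N : ℝ) + h) := by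
    intro n hn
    obtain ⟨hn1, hnN, -, -⟩ := hmemA n hn
    have h1 := (charLog_sub_vonMangoldt_bounds χ hquad (show n + h ≠ 0 by omega)).2
    have hnN' : (n : ℝ) ≤ N := by exact_mod_cast hnN
    have h2 : Real.log ((n + h : ℕ) : ℝ) ≤ Real.log ((N : ℝ) + h) := by
      push_cast
      exact Real.log_le_log (by positivity) (by linarith)
    have h3 : (0 : ℝ) ≤ Real.log ((n + h : ℕ) : ℝ) := Real.log_nonneg (by exact_mod_cast (show 1 ≤ n + h by omega))
    exact h1.trans (mul_le_mul (hτm n hn) h2 h3 (by positivity))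
  -- split by square-freeness of `n + h`
  set A₁ := A.filter (fun n => Squarefree (n + h)) with hA₁
  set A₂ := A.filter (fun n => ¬ Squarefree (n + h)) with hA₂
  have hsplit : ∑ n ∈ A, (n.divisors.card : ℝ) * (charLog χ (n + h) - Λ (n + h)) =
      ∑ n ∈ A₁, (n.divisors.card : ℝ) * (charLog χ (n + h) - Λ (n + h)) +
        ∑ n ∈ A₂, (n.divisors.card : ℝ) * (charLog χ (n + h) - Λ (n + h)) :=
    (Finset.sum_filter_add_sum_filter_not A _ _).symm
  -- Part 2: the non-square-free `n + h`
  have hA₂card : (#A₂ : ℝ) ≤ ((N : ℝ) + h) / (z - 1) + Real.sqrt ((N : ℝ) + h) + 1 := by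
    set Pr := (Icc ⌈z⌉₊ (Nat.sqrt M)).filter Nat.Prime with hPr
    have hcover : A₂ ⊆ Pr.biUnion (fun p => (Icc 1 N).filter (fun n : ℕ => p ^ 2 ∣ n + h)) := by
      intro n hn
      rw [hA₂, Finset.mem_filter] at hn
      obtain ⟨hnA, hnsq⟩ := hn
      obtain ⟨hn1, hnN, -, hr⟩ := hmemA n hnA
      rw [Nat.squarefree_iff_prime_squarefree] at hnsq
      push Not at hnsq
      obtain ⟨p, hp, hp2⟩ := hnsq
      rw [← pow_two] at hp2
      have hpm : p ∈ (n + h).primeFactors :=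
        Nat.mem_primeFactors.mpr ⟨hp, (dvd_pow_self p two_ne_zero).trans hp2, by omega⟩
      have hpz := (hr p hpm).1
      rw [Finset.mem_biUnion]
      refine ⟨p, ?_, Finset.mem_filter.mpr ⟨Finset.mem_Icc.mpr ⟨hn1, hnN⟩, hp2⟩⟩
      rw [hPr, Finset.mem_filter, Finset.mem_Icc]
      refine ⟨⟨Nat.ceil_le.mpr hpz, ?_⟩, hp⟩
      rw [Nat.le_sqrt, ← pow_two]
      exact (Nat.le_of_dvd (by omega) hp2).trans (by omega)
    have h1 : (#A₂ : ℝ) ≤ ∑ p ∈ Pr, (#((Icc 1 N).filter (fun n : ℕ => p ^ 2 ∣ n + h)) : ℝ) := by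
      have := (Finset.card_le_card hcover).trans Finset.card_biUnion_le
      exact_mod_cast this
    have h2 : ∀ p ∈ Pr, (#((Icc 1 N).filter (fun n : ℕ => p ^ 2 ∣ n + h)) : ℝ) ≤
        ((N : ℝ) + h) * (1 / (p : ℝ) ^ 2) + 1 := by
      intro p hp
      have hpp := (Finset.mem_filter.mp hp).2
      have := card_filter_dvd_shift_le N h (p ^ 2) (pow_pos hpp.pos 2)
      push_cast at this
      rw [mul_one_div]; exact this
    have hK2 : 2 ≤ ⌈z⌉₊ := by
      have h4 : (4 : ℝ) ≤ ⌈z⌉₊ := hz.trans (Nat.le_ceil z)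
      exact_mod_cast (show (2 : ℝ) ≤ ⌈z⌉₊ by linarith)
    have h3 : ∑ p ∈ Pr, 1 / (p : ℝ) ^ 2 ≤ 1 / ((⌈z⌉₊ : ℝ) - 1) :=
      sum_inv_sq_tail_le Pr hK2 (fun p hp => (Finset.mem_Icc.mp (Finset.mem_filter.mp hp).1).1)
    have h4 : 1 / ((⌈z⌉₊ : ℝ) - 1) ≤ 1 / (z - 1) :=
      div_le_div_of_nonneg_left zero_le_one (by linarith) (by linarith [Nat.le_ceil z])
    have h5 : (#Pr : ℝ) ≤ Real.sqrt ((N : ℝ) + h) := by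
      have : #Pr ≤ Nat.sqrt M := by
        calc #Pr ≤ #(Icc ⌈z⌉₊ (Nat.sqrt M)) := Finset.card_filter_le _ _
          _ = Nat.sqrt M + 1 - ⌈z⌉₊ := Nat.card_Icc _ _
          _ ≤ Nat.sqrt M := by
              have : 1 ≤ ⌈z⌉₊ := Nat.one_le_iff_ne_zero.mpr (by rw [Ne, Nat.ceil_eq_zero]; linarith)
              omega
      calc (#Pr : ℝ) ≤ Nat.sqrt M := by exact_mod_cast this
        _ ≤ Real.sqrt M := Real.nat_sqrt_le_real_sqrt
        _ = Real.sqrt ((N : ℝ) + h) := by rw [hMr]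
    calc (#A₂ : ℝ) ≤ ∑ p ∈ Pr, (((N : ℝ) + h) * (1 / (p : ℝ) ^ 2) + 1) := h1.trans (Finset.sum_le_sum h2)
      _ = ((N : ℝ) + h) * ∑ p ∈ Pr, 1 / (p : ℝ) ^ 2 + #Pr := by
          rw [Finset.sum_add_distrib, Finset.mul_sum, Finset.sum_const, nsmul_eq_mul, mul_one]
      _ ≤ ((N : ℝ) + h) * (1 / (z - 1)) + Real.sqrt ((N : ℝ) + h) :=
          add_le_add (mul_le_mul_of_nonneg_left (h3.trans h4) hMpos.le) h5
      _ ≤ _ := by rw [mul_one_div]; linarith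
  have hpart2 : ∑ n ∈ A₂, (n.divisors.card : ℝ) * (charLog χ (n + h) - Λ (n + h)) ≤
      (4 : ℝ) ^ u₂ * Real.log ((N : ℝ) + h) * (((N : ℝ) + h) / (z - 1) + Real.sqrt ((N : ℝ) + h) + 1) := by
    have hA₂A : A₂ ⊆ A := Finset.filter_subset _ _
    calc ∑ n ∈ A₂, (n.divisors.card : ℝ) * (charLog χ (n + h) - Λ (n + h))
        ≤ ∑ n ∈ A₂, T₁ * (T₂ * Real.log ((N : ℝ) + h)) := by
          refine Finset.sum_le_sum fun n hn => ?_
          exact mul_le_mul (hτn n (hA₂A hn)) (hcle n (hA₂A hn)) (hc0 n (hA₂A hn)) (by positivity)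
      _ = #A₂ * (T₁ * T₂ * Real.log ((N : ℝ) + h)) := by rw [Finset.sum_const, nsmul_eq_mul]; ring
      _ ≤ (((N : ℝ) + h) / (z - 1) + Real.sqrt ((N : ℝ) + h) + 1) * ((4 : ℝ) ^ u₂ * Real.log ((N : ℝ) + h)) := by
          refine mul_le_mul hA₂card (mul_le_mul_of_nonneg_right hT4 hlogM.le) (by positivity) ?_
          have : 0 < z - 1 := by linarith
          positivity
      _ = _ := by ring
  -- Part 1: the square-free `n + h`
  have hA₁A : A₁ ⊆ A := Finset.filter_subset _ _
  have hpart1a : ∑ n ∈ A₁, (n.divisors.card : ℝ) * (charLog χ (n + h) - Λ (n + h)) ≤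
      T₁ * Real.log ((N : ℝ) + h) * ∑ n ∈ A₁, ∑ p ∈ (n + h).primeFactors, W ((n + h) / p) := by
    rw [Finset.mul_sum]
    refine Finset.sum_le_sum fun n hn => ?_
    have hnA := hA₁A hn
    obtain ⟨hn1, hnN, -, -⟩ := hmemA n hnA
    have hsq : Squarefree (n + h) := (Finset.mem_filter.mp hn).2
    have hc := charLog_sub_vonMangoldt_le_of_squarefree χ hχ (show n + h ≠ 0 by omega) hsq
    have hnN' : (n : ℝ) ≤ N := by exact_mod_cast hnN
    have hlog : Real.log ((n + h : ℕ) : ℝ) ≤ Real.log ((N : ℝ) + h) := by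
      push_cast
      exact Real.log_le_log (by positivity) (by linarith)
    have hsum0 : 0 ≤ ∑ p ∈ (n + h).primeFactors, W ((n + h) / p) := Finset.sum_nonneg fun p _ => hW0 _
    calc (n.divisors.card : ℝ) * (charLog χ (n + h) - Λ (n + h))
        ≤ T₁ * (Real.log ((n + h : ℕ) : ℝ) * ∑ p ∈ (n + h).primeFactors, W ((n + h) / p)) :=
          mul_le_mul (hτn n hnA) hc (hc0 n hnA) (by positivity)
      _ ≤ T₁ * (Real.log ((N : ℝ) + h) * ∑ p ∈ (n + h).primeFactors, W ((n + h) / p)) :=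
          mul_le_mul_of_nonneg_left (mul_le_mul_of_nonneg_right hlog hsum0) (by positivity)
      _ = _ := by ring
  -- the double sum, reindexed by `e = (n + h)/p`
  have hdouble : ∑ n ∈ A₁, ∑ p ∈ (n + h).primeFactors, W ((n + h) / p) ≤
      C₁ * F * Real.exp (u₂ / (z - 1)) * (((N : ℝ) + h) / Real.log z ^ 2) * (Real.exp (2 * S) - 1) := by
    -- the set of pairs and the map to `e`
    set Pairs := A₁.sigma (fun n => (n + h).primeFactors) with hPairs
    set g : ((_ : ℕ) × ℕ) → ℕ := fun x => (x.1 + h) / x.2 with hg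
    have hsum : ∑ n ∈ A₁, ∑ p ∈ (n + h).primeFactors, W ((n + h) / p) = ∑ x ∈ Pairs, W (g x) := by
      rw [Finset.sum_sigma]
    rw [hsum, Finset.sum_comp]
    -- the candidate set for `e`
    set E := (Pairs.image g).filter (fun e => 1 < e ∧ ∀ p' ∈ e.primeFactors, DirichletAbel.reChar χ p' ≠ -1)
      with hE
    have hstep1 : ∑ e ∈ Pairs.image g, (#(Pairs.filter (fun x => g x = e)) : ℕ) • W e =
        ∑ e ∈ E, (#(Pairs.filter (fun x => g x = e)) : ℝ) * (2 : ℝ) ^ e.primeFactors.card := by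
      rw [hE, Finset.sum_filter]
      refine Finset.sum_congr rfl fun e _ => ?_
      simp only [hW, nsmul_eq_mul]
      split_ifs <;> simp
    rw [hstep1]
    -- facts about `e ∈ E`
    have hEfacts : ∀ e ∈ E, 1 < e ∧ Squarefree e ∧ (∀ p' ∈ e.primeFactors, z ≤ (p' : ℝ) ∧ (χ (p' : ZMod q)) ≠ -1) ∧
        (e : ℝ) * z ≤ (N : ℝ) + h ∧ e ≤ M := by
      intro e he
      rw [hE, Finset.mem_filter, Finset.mem_image] at he
      obtain ⟨⟨x, hx, rfl⟩, h1e, hexc⟩ := he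
      rw [hPairs, Finset.mem_sigma] at hx
      obtain ⟨hnA₁, hp⟩ := hx
      have hnA := hA₁A hnA₁
      obtain ⟨hn1, hnN, -, hr⟩ := hmemA x.1 hnA
      have hsq : Squarefree (x.1 + h) := (Finset.mem_filter.mp hnA₁).2
      have hpp := Nat.prime_of_mem_primeFactors hp
      have hpdvd := Nat.dvd_of_mem_primeFactors hp
      have hediv : g x ∣ x.1 + h := Nat.div_dvd_of_dvd hpdvd
      have hpz := (hr x.2 hp).1
      refine ⟨h1e, hsq.squarefree_of_dvd hediv, fun p' hp' => ?_, ?_, ?_⟩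
      · have hp'm : p' ∈ (x.1 + h).primeFactors := Nat.primeFactors_mono hediv (by omega) hp'
        refine ⟨(hr p' hp'm).1, fun hneg => hexc p' hp' ?_⟩
        rw [DirichletAbel.reChar_apply χ (Nat.prime_of_mem_primeFactors hp').ne_zero, hneg]
        norm_num
      · have hmul : g x * x.2 = x.1 + h := Nat.div_mul_cancel hpdvd
        have : ((g x : ℕ) : ℝ) * x.2 = (x.1 : ℝ) + h := by exact_mod_cast hmul
        have hx1N : (x.1 : ℝ) ≤ N := by exact_mod_cast hnN
        calc ((g x : ℕ) : ℝ) * z ≤ (g x : ℝ) * x.2 := mul_le_mul_of_nonneg_left hpz (Nat.cast_nonneg _)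
          _ = (x.1 : ℝ) + h := this
          _ ≤ (N : ℝ) + h := by linarith
      · exact (Nat.div_le_self _ _).trans (by omega)
    -- the fibre over `e` injects into the sieve set
    have hfibre : ∀ e ∈ E, (#(Pairs.filter (fun x => g x = e)) : ℝ) ≤
        C₁ * ((((e * h : ℕ)) : ℝ) / Nat.totient (e * h)) * (((N : ℝ) + h) / e) / Real.log z ^ 2 := by
      intro e he
      obtain ⟨h1e, -, -, hez, -⟩ := hEfacts e he
      have hcount := HC N h e z hh (by omega) hz hez
      refine le_trans ?_ hcount
      have hinj : Set.InjOn (fun x : ((_ : ℕ) × ℕ) => x.1) (Pairs.filter (fun x => g x = e) : Finset ((_ : ℕ) × ℕ)) := by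
        intro x hx y hy hxy
        rw [Finset.coe_filter, Set.mem_setOf_eq] at hx hy
        obtain ⟨hxP, hxe⟩ := hx
        obtain ⟨hyP, hye⟩ := hy
        rw [hPairs, Finset.mem_sigma] at hxP hyP
        have he0 : e ≠ 0 := by omega
        have hx2 : x.2 = (x.1 + h) / e := by
          have := Nat.div_mul_cancel (Nat.dvd_of_mem_primeFactors hxP.2)
          rw [hg] at hxe; simp only at hxe
          rw [hxe] at this
          exact Nat.eq_div_of_mul_eq_right he0 this
        have hy2 : y.2 = (y.1 + h) / e := by
          have := Nat.div_mul_cancel (Nat.dvd_of_mem_primeFactors hyP.2)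
          rw [hg] at hye; simp only at hye
          rw [hye] at this
          exact Nat.eq_div_of_mul_eq_right he0 this
        simp only at hxy
        ext
        · exact hxy
        · simp only [heq_eq_eq]; rw [hx2, hy2, hxy]
      have hmap : ∀ x ∈ Pairs.filter (fun x => g x = e), x.1 ∈ (Icc 1 N).filter (fun n : ℕ =>
          (∀ p ∈ n.primeFactors, z ≤ (p : ℝ)) ∧ e ∣ n + h ∧ ((n + h) / e).Prime ∧ z ≤ (((n + h) / e : ℕ) : ℝ)) := by
        intro x hx
        rw [Finset.mem_filter] at hx
        obtain ⟨hxP, hxe⟩ := hx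
        rw [hPairs, Finset.mem_sigma] at hxP
        obtain ⟨hnA₁, hp⟩ := hxP
        obtain ⟨hn1, hnN, hrn, hr⟩ := hmemA x.1 (hA₁A hnA₁)
        have hpdvd := Nat.dvd_of_mem_primeFactors hp
        have hmul : e * x.2 = x.1 + h := by rw [← hxe]; exact Nat.div_mul_cancel hpdvd
        have hediv : e ∣ x.1 + h := ⟨x.2, hmul.symm⟩
        have hquot : (x.1 + h) / e = x.2 := Nat.div_eq_of_eq_mul_right (by omega) hmul.symm
        rw [Finset.mem_filter, Finset.mem_Icc, hquot]
        exact ⟨⟨hn1, hnN⟩, hrn, hediv, Nat.prime_of_mem_primeFactors hp, (hr x.2 hp).1⟩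
      exact_mod_cast Finset.card_le_card_of_injOn _ hmap hinj
    -- sum over `e`
    have hstep2 : ∑ e ∈ E, (#(Pairs.filter (fun x => g x = e)) : ℝ) * (2 : ℝ) ^ e.primeFactors.card ≤
        ∑ e ∈ E, (C₁ * F * Real.exp (u₂ / (z - 1)) * (((N : ℝ) + h) / Real.log z ^ 2)) *
          ((2 : ℝ) ^ e.primeFactors.card / e) := by
      refine Finset.sum_le_sum fun e he => ?_
      obtain ⟨h1e, hsqe, hpe, hez, heM⟩ := hEfacts e he
      have he0 : e ≠ 0 := by omega
      have hepos : (0 : ℝ) < e := by exact_mod_cast (show 0 < e by omega)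
      have hφ : (((e * h : ℕ)) : ℝ) / Nat.totient (e * h) ≤ Real.exp (u₂ / (z - 1)) * F := by
        refine (mul_div_totient_le he0 (by omega)).trans (mul_le_mul_of_nonneg_right ?_ (by positivity))
        refine (self_div_totient_le_exp_of_rough he0 hz1 (fun p hp => (hpe p hp).1)).trans (Real.exp_le_exp.2 ?_)
        refine div_le_div_of_nonneg_right ?_ (by linarith)
        have := card_primeFactors_le_log_div' he0 hz1 (fun p hp => (hpe p hp).1)
        refine this.trans (div_le_div_of_nonneg_right (Real.log_le_log hepos ?_) hlogz.le)
        rw [← hMr]; exact_mod_cast heM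
      calc (#(Pairs.filter (fun x => g x = e)) : ℝ) * (2 : ℝ) ^ e.primeFactors.card
          ≤ (C₁ * ((((e * h : ℕ)) : ℝ) / Nat.totient (e * h)) * (((N : ℝ) + h) / e) / Real.log z ^ 2) *
            (2 : ℝ) ^ e.primeFactors.card := mul_le_mul_of_nonneg_right (hfibre e he) (by positivity)
        _ ≤ (C₁ * (Real.exp (u₂ / (z - 1)) * F) * (((N : ℝ) + h) / e) / Real.log z ^ 2) *
            (2 : ℝ) ^ e.primeFactors.card := by gcongr
        _ = _ := by field_simp
    refine hstep2.trans ?_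
    rw [← Finset.mul_sum]
    refine mul_le_mul_of_nonneg_left ?_ (by positivity)
    -- the Euler product over exceptional primes
    have hEuler := sum_two_pow_div_le_prod_sub_one P (fun p hp => ((SiegelZero.mem_excPrimes.mp hp).2.1)) E ?_
    · refine hEuler.trans ?_
      linarith [prod_one_add_two_div_le_exp P]
    · intro e he
      obtain ⟨h1e, hsqe, hpe, hez, heM⟩ := hEfacts e he
      refine ⟨hsqe, by omega, fun p hp => ?_⟩
      obtain ⟨hpz, hpχ⟩ := hpe p hp
      rw [hP, SiegelZero.mem_excPrimes, Finset.mem_Icc]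
      refine ⟨⟨Nat.ceil_le.mpr hpz, ?_⟩, Nat.prime_of_mem_primeFactors hp, hpχ⟩
      exact (Nat.le_of_mem_primeFactors hp).trans heM
  -- assemble
  have hpart1 : ∑ n ∈ A₁, (n.divisors.card : ℝ) * (charLog χ (n + h) - Λ (n + h)) ≤
      C₁ * F * T₁ * Real.exp (u₂ / (z - 1)) * (((N : ℝ) + h) * Real.log ((N : ℝ) + h) / Real.log z ^ 2) *
        (Real.exp (2 * S) - 1) := by
    refine hpart1a.trans ?_
    have := mul_le_mul_of_nonneg_left hdouble (show 0 ≤ T₁ * Real.log ((N : ℝ) + h) by positivity)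
    refine this.trans (le_of_eq ?_)
    ring
  have hS0 : 0 ≤ S := Finset.sum_nonneg fun p _ => by positivity
  have hexpS : 0 ≤ Real.exp (2 * S) - 1 := by linarith [Real.add_one_le_exp (2 * S)]
  have hC₁le : C₁ ≤ max C₁ 1 := le_max_left _ _
  have h1le : (1 : ℝ) ≤ max C₁ 1 := le_max_right _ _
  rw [hsplit]
  have hX1 : 0 ≤ F * T₁ * Real.exp (u₂ / (z - 1)) * (((N : ℝ) + h) * Real.log ((N : ℝ) + h) / Real.log z ^ 2) *
      (Real.exp (2 * S) - 1) := by positivity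
  have hX2 : 0 ≤ (4 : ℝ) ^ u₂ * Real.log ((N : ℝ) + h) * (((N : ℝ) + h) / (z - 1) + Real.sqrt ((N : ℝ) + h) + 1) := by
    have : 0 < z - 1 := by linarith
    positivity
  calc _ ≤ C₁ * F * T₁ * Real.exp (u₂ / (z - 1)) * (((N : ℝ) + h) * Real.log ((N : ℝ) + h) / Real.log z ^ 2) *
        (Real.exp (2 * S) - 1) +
        (4 : ℝ) ^ u₂ * Real.log ((N : ℝ) + h) * (((N : ℝ) + h) / (z - 1) + Real.sqrt ((N : ℝ) + h) + 1) :=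
        add_le_add hpart1 hpart2
    _ ≤ (max C₁ 1) * (F * T₁ * Real.exp (u₂ / (z - 1)) * (((N : ℝ) + h) * Real.log ((N : ℝ) + h) / Real.log z ^ 2) *
        (Real.exp (2 * S) - 1)) +
        (max C₁ 1) * ((4 : ℝ) ^ u₂ * Real.log ((N : ℝ) + h) * (((N : ℝ) + h) / (z - 1) + Real.sqrt ((N : ℝ) + h) + 1)) := by
        have e1 : C₁ * F * T₁ * Real.exp (u₂ / (z - 1)) * (((N : ℝ) + h) * Real.log ((N : ℝ) + h) / Real.log z ^ 2) *
            (Real.exp (2 * S) - 1) = C₁ * (F * T₁ * Real.exp (u₂ / (z - 1)) *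
              (((N : ℝ) + h) * Real.log ((N : ℝ) + h) / Real.log z ^ 2) * (Real.exp (2 * S) - 1)) := by ring
        rw [e1]
        refine add_le_add (mul_le_mul_of_nonneg_right hC₁le hX1) ?_
        calc _ = 1 * ((4 : ℝ) ^ u₂ * Real.log ((N : ℝ) + h) * (((N : ℝ) + h) / (z - 1) + Real.sqrt ((N : ℝ) + h) + 1)) :=
              (one_mul _).symm
          _ ≤ _ := mul_le_mul_of_nonneg_right h1le hX2
    _ = _ := by ring


/-! ### At the exceptional zero -/

/-- **The `τ(n) c_{n+h}`-part of Matomäki–Merikoski's Lemma 2.1 at a Siegel zero.** There are `K > 0`,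
`η₀` such that for every primitive quadratic `χ (mod q)` with `L(1 − 1/(η log q), χ) = 0`, `η ≥ η₀`, every
`v > 0`, writing `z = q^v`, and all `N h ∈ ℕ` with `1 ≤ h`, `4 ≤ z ≤ N` and
`B := 1/(v²η^{v/2}) + (v/η) log(N+h)/log z ≤ 1`:
`∑_{adm n ≤ N} τ(n) c_{n+h} ≤ K (h/φ(h)) 2^{log N/log z} e^{(log(N+h)/log z)/(z−1)} ((N+h) log(N+h)/log² z) B`
`+ K 4^{log(N+h)/log z} log(N+h) ((N+h)/(z−1) + √(N+h) + 1)`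
("adm": every prime factor of `n` and of `n + h` is `≥ z` and coprime to `q`; `c = χ ∗ log − Λ`).
With `z = N^{1/u}`, `u ≤ z − 1`, this is `≪ (h/φ(h)) 2^u u² (N/log N)(1/(v²η^{v/2}) + uv/η) + 4^u N log N/z`,
the source's Lemma 2.1 + Lemma 2.2 with `2^u` in place of `u⁴` (see the module docstring).
[cite: MatomakiMerikoski2023, Lemma 2.1 and Lemma 2.2] -/
theorem sum_adm_tau_mul_charLog_sub_vonMangoldt_shift_le_of_exceptionalZero :
    ∃ K η₀ : ℝ, 0 < K ∧ ∀ (q : ℕ) [NeZero q] (χ : DirichletCharacter ℂ q), χ.IsPrimitive → χ.IsQuadratic →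
      ∀ η : ℝ, η₀ ≤ η → χ.LFunction ((1 - 1 / (η * Real.log q) : ℝ) : ℂ) = 0 →
      ∀ v : ℝ, 0 < v → ∀ (N h : ℕ), 1 ≤ h → 4 ≤ (q : ℝ) ^ v → (q : ℝ) ^ v ≤ N →
        1 / (v ^ 2 * η ^ (v / 2)) + v / η * (Real.log ((N : ℝ) + h) / Real.log ((q : ℝ) ^ v)) ≤ 1 →
        ∑ n ∈ (Icc 1 N).filter (fun n : ℕ =>
            (∀ p ∈ n.primeFactors, (q : ℝ) ^ v ≤ (p : ℝ) ∧ ¬ p ∣ q) ∧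
              (∀ p ∈ (n + h).primeFactors, (q : ℝ) ^ v ≤ (p : ℝ) ∧ ¬ p ∣ q)),
            (n.divisors.card : ℝ) * (charLog χ (n + h) - Λ (n + h)) ≤
          K * ((h : ℝ) / Nat.totient h) * (2 : ℝ) ^ (Real.log N / Real.log ((q : ℝ) ^ v)) *
              Real.exp ((Real.log ((N : ℝ) + h) / Real.log ((q : ℝ) ^ v)) / ((q : ℝ) ^ v - 1)) *
              (((N : ℝ) + h) * Real.log ((N : ℝ) + h) / Real.log ((q : ℝ) ^ v) ^ 2) *
              (1 / (v ^ 2 * η ^ (v / 2)) + v / η * (Real.log ((N : ℝ) + h) / Real.log ((q : ℝ) ^ v))) +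
            K * (4 : ℝ) ^ (Real.log ((N : ℝ) + h) / Real.log ((q : ℝ) ^ v)) * Real.log ((N : ℝ) + h) *
              (((N : ℝ) + h) / ((q : ℝ) ^ v - 1) + Real.sqrt ((N : ℝ) + h) + 1) := by
  obtain ⟨C, hC, HC⟩ := sum_adm_tau_mul_charLog_sub_vonMangoldt_shift_le
  obtain ⟨Cw, η₀, hCw, HW⟩ := exists_sum_excPrimes_window_le
  refine ⟨max (C * (2 * Cw * Real.exp (2 * Cw))) C, η₀, by positivity, ?_⟩
  intro q _ χ hprim hquad η hη hL v hv N h hh hz hzN hB1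
  set z : ℝ := (q : ℝ) ^ v with hz_def
  have hχ2 : χ ^ 2 = 1 := MulChar.isQuadratic_iff_sq_eq_one.mp hquad
  set B : ℝ := 1 / (v ^ 2 * η ^ (v / 2)) + v / η * (Real.log ((N : ℝ) + h) / Real.log z) with hB_def
  have hmain := HC q χ hχ2 N h z hh hz hzN
  -- the window sum
  have hY : z ≤ (((N + h : ℕ)) : ℝ) := by push_cast; linarith [show (0 : ℝ) ≤ h from Nat.cast_nonneg h]
  have hwin := HW q χ hprim hquad η hη hL v hv (((N + h : ℕ)) : ℝ) hY
  rw [Nat.floor_natCast] at hwin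
  have hNh : (((N + h : ℕ)) : ℝ) = (N : ℝ) + h := by push_cast; ring
  rw [hNh] at hwin
  set S : ℝ := ∑ p ∈ SiegelZero.excPrimes χ (Icc ⌈z⌉₊ (N + h)), 1 / (p : ℝ) with hS
  have hS0 : 0 ≤ S := Finset.sum_nonneg fun p _ => by positivity
  have hSB : S ≤ Cw * B := hwin
  have hB0 : 0 ≤ B := by
    have := hS0.trans hSB
    exact le_of_mul_le_mul_left (by simpa using this) hCw
  -- `exp(2S) − 1 ≤ 2S exp(2S) ≤ 2 Cw B exp(2Cw)`
  have hexp : Real.exp (2 * S) - 1 ≤ (2 * Cw * Real.exp (2 * Cw)) * B := by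
    have h1 : Real.exp (2 * S) - 1 ≤ 2 * S * Real.exp (2 * S) := by
      -- `e^x − 1 ≤ x e^x` (tree: `Literature.Analysis.ODE.exp_sub_one_le_mul_exp`; inlined to keep imports light)
      have ha := Real.add_one_le_exp (-(2 * S))
      have hb : Real.exp (2 * S) * Real.exp (-(2 * S)) = 1 := by rw [← Real.exp_add]; simp
      nlinarith [Real.exp_pos (2 * S), Real.exp_pos (-(2 * S))]
    have h2 : 2 * S ≤ 2 * Cw * B := by linarith
    have h3 : Real.exp (2 * S) ≤ Real.exp (2 * Cw) := Real.exp_le_exp.2 (by nlinarith)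
    calc Real.exp (2 * S) - 1 ≤ 2 * S * Real.exp (2 * S) := h1
      _ ≤ (2 * Cw * B) * Real.exp (2 * Cw) := mul_le_mul h2 h3 (Real.exp_pos _).le (by positivity)
      _ = _ := by ring
  -- assemble
  have hz1 : 1 < z := by linarith
  have hK1 : C * (2 * Cw * Real.exp (2 * Cw)) ≤ max (C * (2 * Cw * Real.exp (2 * Cw))) C := le_max_left _ _
  have hK2 : C ≤ max (C * (2 * Cw * Real.exp (2 * Cw))) C := le_max_right _ _
  have hφ0 : (0 : ℝ) ≤ (h : ℝ) / Nat.totient h := by positivity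
  have hh1 : (1 : ℝ) ≤ h := by exact_mod_cast hh
  have hN0 : (0 : ℝ) ≤ N := Nat.cast_nonneg N
  have hlogM0 : 0 ≤ Real.log ((N : ℝ) + h) := Real.log_nonneg (by linarith)
  have hlogz0 : 0 < Real.log z := Real.log_pos hz1
  have hz10 : 0 < z - 1 := by linarith
  have hP1 : 0 ≤ ((h : ℝ) / Nat.totient h) * (2 : ℝ) ^ (Real.log N / Real.log z) *
      Real.exp ((Real.log ((N : ℝ) + h) / Real.log z) / (z - 1)) *
      (((N : ℝ) + h) * Real.log ((N : ℝ) + h) / Real.log z ^ 2) := by positivity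
  have hP2 : 0 ≤ (4 : ℝ) ^ (Real.log ((N : ℝ) + h) / Real.log z) * Real.log ((N : ℝ) + h) *
      (((N : ℝ) + h) / (z - 1) + Real.sqrt ((N : ℝ) + h) + 1) := by positivity
  refine hmain.trans ?_
  calc C * ((h : ℝ) / Nat.totient h) * (2 : ℝ) ^ (Real.log N / Real.log z) *
          Real.exp ((Real.log ((N : ℝ) + h) / Real.log z) / (z - 1)) *
          (((N : ℝ) + h) * Real.log ((N : ℝ) + h) / Real.log z ^ 2) * (Real.exp (2 * S) - 1) +
        C * (4 : ℝ) ^ (Real.log ((N : ℝ) + h) / Real.log z) * Real.log ((N : ℝ) + h) *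
          (((N : ℝ) + h) / (z - 1) + Real.sqrt ((N : ℝ) + h) + 1)
      ≤ C * ((h : ℝ) / Nat.totient h) * (2 : ℝ) ^ (Real.log N / Real.log z) *
          Real.exp ((Real.log ((N : ℝ) + h) / Real.log z) / (z - 1)) *
          (((N : ℝ) + h) * Real.log ((N : ℝ) + h) / Real.log z ^ 2) * ((2 * Cw * Real.exp (2 * Cw)) * B) +
        C * (4 : ℝ) ^ (Real.log ((N : ℝ) + h) / Real.log z) * Real.log ((N : ℝ) + h) *
          (((N : ℝ) + h) / (z - 1) + Real.sqrt ((N : ℝ) + h) + 1) := by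
        refine add_le_add (mul_le_mul_of_nonneg_left hexp ?_) le_rfl
        positivity
    _ = (C * (2 * Cw * Real.exp (2 * Cw))) * (((h : ℝ) / Nat.totient h) * (2 : ℝ) ^ (Real.log N / Real.log z) *
          Real.exp ((Real.log ((N : ℝ) + h) / Real.log z) / (z - 1)) *
          (((N : ℝ) + h) * Real.log ((N : ℝ) + h) / Real.log z ^ 2)) * B +
        C * ((4 : ℝ) ^ (Real.log ((N : ℝ) + h) / Real.log z) * Real.log ((N : ℝ) + h) *
          (((N : ℝ) + h) / (z - 1) + Real.sqrt ((N : ℝ) + h) + 1)) := by ring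
    _ ≤ (max (C * (2 * Cw * Real.exp (2 * Cw))) C) * (((h : ℝ) / Nat.totient h) * (2 : ℝ) ^ (Real.log N / Real.log z) *
          Real.exp ((Real.log ((N : ℝ) + h) / Real.log z) / (z - 1)) *
          (((N : ℝ) + h) * Real.log ((N : ℝ) + h) / Real.log z ^ 2)) * B +
        (max (C * (2 * Cw * Real.exp (2 * Cw))) C) * ((4 : ℝ) ^ (Real.log ((N : ℝ) + h) / Real.log z) * Real.log ((N : ℝ) + h) *
          (((N : ℝ) + h) / (z - 1) + Real.sqrt ((N : ℝ) + h) + 1)) := by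
        refine add_le_add ?_ (mul_le_mul_of_nonneg_right hK2 hP2)
        exact mul_le_mul_of_nonneg_right (mul_le_mul_of_nonneg_right hK1 hP1) hB0
    _ = _ := by ring

end Literature.Barriers.Parity.MatomakiMerikoski
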